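import Mathlib
import Literature.Probability.LatticeModels.Sharpness
import Literature.Probability.LatticeModels.GibbsStates
import HarnessLib

/-!
# The spectral (Källén–Lehmann) representation of the two-point function along a principal axis
(Aizenman–Duminil-Copin 2021, Appendix A.3, Prop. 8.6 = Prop. 5.3)

Topic `Literature/Probability/LatticeModels`; family `crit-ising`. Named fact (statement only,
D-0014) + two proved corollaries. Consumers: route
`Summits/CriticalPhenomena/Ising3DConformalLimit/Theses/ThresholdDilation`, item
`AxisKallenLehmann` (stmt-CriticalPhenomena-6328) — which is the Hausdorff-moment corollary
`AizenmanDuminilCopin2021_prop_8_6.criticalAxis` at `d = 3`, `i = 0` — and the cards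
crossover-witness-no-doubling, rp-cannot-fix-the-scale-log-periodic,
every-scale-regular-multiplicative-fekete, lattice-sdp-certificates, mirror-hoelder-modulus listed
there; the finite-volume mechanism is already PROVED in the tree (`TorusTransferSpectral.lean`,
`TwoPointLogConvex.lean`: positivity of the transfer matrix, exact log-convexity), this file records
the printed infinite-volume statement.

**Source (held, read at the page: arXiv:1912.07973 = Ann. of Math. 194 (2021), Appendix §8.3,
our text chunks p0032 L45 – p0033 L75).** M. Aizenman, H. Duminil-Copin, *Marginal triviality of
the scaling limits of critical 4D Ising and `λφ⁴₄` models*: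

> **Proposition 8.6 (Spectral Representation).** Let `ρ₀` be a single variable distribution for
> which the Gibbs states on `ℤ^d` with the n.n.f. Hamiltonian satisfies `⟨|τ₀|²⟩_β < ∞`, `∀ β ≥ 0`.
> Then, for every `0 < β < ∞` and every square-summable `v ∈ ℓ²(ℤ^{d-1})`, there exists a positive
> measure `μ_{v,β}` with a total mass satisfying `μ_{v,β}([0,∞)) ≤ ‖v‖₂² ⟨|τ₀|²⟩_β` such that for
> every `n ∈ ℤ`, `∑_{x_⊥,y_⊥ ∈ ℤ^{d-1}} v_{x_⊥} \overline{v_{y_⊥}} S_β((n, x_⊥ − y_⊥)) = ∫₀^∞ e^{−a|n|} dμ_{v,β}(a)`.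
> […] In particular, with `v = δ_⊥` the Kronecker function (at the origin) on `ℤ^{d-1}`, this
> yields the following spectral representation for the correlation function along a principal axis
> `S_β((n, 0_⊥)) = ∫ e^{−a|n|} dμ_{δ_⊥,β}(a)`, with a measure whose total mass is
> `μ_{δ_⊥,β}([0,∞)) = ⟨|τ₀|²⟩_β`. […] One may observe that the above result applies to all `β`.

(Body, §5.3 Prop. 5.3, p0017 L51–64: the same for `β < β_c` with support in `[1/ξ(β), ∞)`,
"quite well-known (cf. [GliJaf73])"; proof p0033 L1–68: transfer matrix on periodic tubes
`ℤ × (ℤ/ℓℤ)^{d-1}`, positivity, moments of `e^{−a}` on `[0,1]`, `ℓ → ∞` by the moment criterion.)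

## Content

* `AizenmanDuminilCopin2021_prop_8_6` — the axis case `v = δ_⊥` for the nearest-neighbour ISING
  model (`ρ₀ = ½(δ₋₁ + δ₁)`, `⟨|τ₀|²⟩ = 1`) in every direction `i`, in the regime `m*(β) = 0`:
  `⟨σ₀ σ_{n eᵢ}⟩⁺_β = ∫ e^{−a|n|} dμ(a)` for all `n ∈ ℤ`, `μ` a finite positive measure carried by
  `[0, ∞)`. Named fact, statement only.
* PROVED from it: `….hausdorffMoment` — the change of variables `λ = e^{−a}`: a finite positive
  measure `ν` on `[0,1]` with `⟨σ₀ σ_{n eᵢ}⟩⁺_β = ∫ λⁿ dν(λ)` for all `n ∈ ℕ` (Hausdorff moment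
  sequence; Glimm–Jaffe 1977 Prop. 2.2 form); `….criticalAxis` — the same at `β = β_c(d)`, `d ≥ 3`,
  given the tree's named facts `spontaneousMagnetization_criticalBeta_eq_zero` (S09, ADS 2015,
  PROVED: `…_holds`, `CriticalTwoPointBounds.lean`) and `criticalBeta_pos` (PROVED: `…_holds`,
  `CriticalTwoPointLower.lean`) as hypotheses — exactly item `AxisKallenLehmann` for `d = 3`.

## Faithfulness notes

* SPECIALISATION, same cite: Ising single-site law only (the tree's `twoPointPlus`), `v = δ_⊥` only
  (the general `ℓ²` statement needs a quadratic-form vocabulary the consumers do not use; the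
  finite-support version is the PROVED `axisForm` machinery of `TwoPointLogConvex.lean`).
* THE STATE. The source's `S_β` is the infinite-volume n.n.f. Gibbs state obtained as the limit of
  periodic tubes (proof, p0033: "through the FKG inequality … converges pointwise"). We render it by
  the plus state `twoPointPlus d β` AND restrict to `m*(β) = 0` (`spontaneousMagnetization d β = 0`:
  all `β < β_c`, and `β = β_c` for `d ≥ 3`), where the infinite-volume state is unique and periodic /
  free / plus two-point functions coincide (tree: `TorusTwoPointLimit.lean`,
  `freeCorr_eq_plusCorr_of_spontaneousMagnetization_eq_zero`) — so no identification of states is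
  smuggled in; this is weaker than "all `β`" and covers every consumer.
* `0 < β` as printed; at `β = 0` the statement is trivial (`μ = δ`-mass giving `𝟙[n = 0]`… not
  claimed).
* "positive measure with total mass …" ⇒ `IsFiniteMeasure`; "on `[0, ∞)`" ⇒ `μ (Ici 0)ᶜ = 0`; the
  total-mass identity is the case `n = 0` of the displayed formula (`⟨σ₀²⟩ = 1`) and is not
  repeated.

## References

* M. Aizenman, H. Duminil-Copin, Ann. of Math. 194 (2021) 163–235, arXiv:1912.07973: Prop. 5.3
  (§5.3) and Appendix §8.3 Prop. 8.6 with its proof. [AizenmanDuminilCopinAnnals2021]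
* J. Glimm, A. Jaffe, Comm. Math. Phys. 52 (1977) 203–209, Prop. 2.2; *Quantum Physics* (1987)
  §6.1 (transfer matrix, spectral representation) — cited by the source as [GliJaf73].
-/

noncomputable section

open MeasureTheory Set

namespace Literature.Probability.LatticeModels

/-- **Aizenman–Duminil-Copin 2021, Prop. 8.6 / Prop. 5.3 (spectral representation of the
two-point function along a principal axis), nearest-neighbour Ising case, regime `m*(β) = 0`.**
Printed (Appendix §8.3): "for every `0 < β < ∞` … there exists a positive measure `μ_{v,β}` … such
that for every `n ∈ ℤ`, `∑ v_{x_⊥} v̄_{y_⊥} S_β((n, x_⊥ − y_⊥)) = ∫₀^∞ e^{−a|n|} dμ_{v,β}(a)`. In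
particular, with `v = δ_⊥` … `S_β((n,0_⊥)) = ∫ e^{−a|n|} dμ_{δ_⊥,β}(a)`, with a measure whose total
mass is `⟨|τ₀|²⟩_β` … the above result applies to all `β`." Tree rendering: for every dimension
`d' + 1`, every `β > 0` with `spontaneousMagnetization (d'+1) β = 0` and every axis `i`, there is
a finite measure `μ` on `ℝ` carried by `[0, ∞)` with
`twoPointPlus (d'+1) β (n eᵢ) = ∫ exp (−(a |n|)) dμ(a)` for all `n : ℤ`. Statement only (D-0014);
the finite-volume transfer-matrix mechanism is proved in `TorusTransferSpectral.lean` /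
`TwoPointLogConvex.lean`. [cite: AizenmanDuminilCopinAnnals2021, Appendix §8.3 Prop. 8.6 (= Prop. 5.3)] -/
def AizenmanDuminilCopin2021_prop_8_6 : Prop :=
  ∀ (d' : ℕ) (β : ℝ), 0 < β → spontaneousMagnetization (d' + 1) β = 0 → ∀ i : Fin (d' + 1),
    ∃ μ : Measure ℝ, IsFiniteMeasure μ ∧ μ (Set.Ici (0 : ℝ))ᶜ = 0 ∧
      ∀ n : ℤ, twoPointPlus (d' + 1) β (Pi.single i n) = ∫ a, Real.exp (-(a * |(n : ℝ)|)) ∂μ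

/-- **Hausdorff-moment form** (change of variables `λ = e^{−a} ∈ (0, 1]`; the shape of Glimm–Jaffe
1977 Prop. 2.2 and of item `AxisKallenLehmann`): under Prop. 8.6, for `β > 0` with `m*(β) = 0` the
axis two-point function is the moment sequence of a finite positive measure on `[0, 1]`.
[cite: AizenmanDuminilCopinAnnals2021, Appendix §8.3 Prop. 8.6 (= Prop. 5.3)] -/
theorem AizenmanDuminilCopin2021_prop_8_6.hausdorffMoment (h : AizenmanDuminilCopin2021_prop_8_6)
    {d' : ℕ} {β : ℝ} (hβ : 0 < β) (hm : spontaneousMagnetization (d' + 1) β = 0) (i : Fin (d' + 1)) :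
    ∃ ν : Measure ℝ, IsFiniteMeasure ν ∧ ν (Set.Icc (0 : ℝ) 1)ᶜ = 0 ∧
      ∀ n : ℕ, twoPointPlus (d' + 1) β (Pi.single i ((n : ℕ) : ℤ)) = ∫ t, t ^ n ∂ν := by
  obtain ⟨μ, hfin, hsupp, hrep⟩ := h d' β hβ hm i
  have hf : Measurable fun a : ℝ => Real.exp (-a) := Real.measurable_exp.comp measurable_neg
  refine ⟨μ.map fun a => Real.exp (-a), inferInstance, ?_, fun n => ?_⟩
  · rw [Measure.map_apply hf (measurableSet_Icc.compl)]
    refine measure_mono_null (fun a ha => ?_) hsupp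
    simp only [mem_preimage, mem_compl_iff, mem_Icc, not_and, not_le, mem_Ici] at ha ⊢
    have hpos : (0 : ℝ) ≤ Real.exp (-a) := (Real.exp_pos _).le
    have h1 : 1 < Real.exp (-a) := ha hpos
    have : 0 < -a := by
      by_contra hle
      have := Real.exp_le_one_iff.mpr (not_lt.mp hle)
      linarith
    linarith
  · rw [integral_map hf.aemeasurable (continuous_pow n).aestronglyMeasurable, hrep n]
    refine integral_congr_ae (Filter.Eventually.of_forall fun a => ?_)
    simp only [Int.cast_natCast, Nat.abs_cast]
    rw [← Real.exp_nat_mul]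
    ring_nf

/-- **The critical axis two-point function of the `d ≥ 3` Ising model is a Hausdorff moment
sequence** — item `AxisKallenLehmann` of route ThresholdDilation for `d = 3`: given Prop. 8.6, the
tree facts S09 `m*(β_c) = 0` (`spontaneousMagnetization_criticalBeta_eq_zero`, PROVED as `…_holds`)
and `β_c > 0` (`criticalBeta_pos`, PROVED as `…_holds`), there is a finite positive measure `ν` on
`[0,1]` with `⟨σ₀ σ_{n eᵢ}⟩⁺_{β_c} = ∫ λⁿ dν` for all `n`.
[cite: AizenmanDuminilCopinAnnals2021, Appendix §8.3 Prop. 8.6 (= Prop. 5.3)] -/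
theorem AizenmanDuminilCopin2021_prop_8_6.criticalAxis (h : AizenmanDuminilCopin2021_prop_8_6)
    {d' : ℕ} (hd : 3 ≤ d' + 1)
    (hS09 : spontaneousMagnetization_criticalBeta_eq_zero (d := d' + 1))
    (hpos : criticalBeta_pos (d := d' + 1)) (i : Fin (d' + 1)) :
    ∃ ν : Measure ℝ, IsFiniteMeasure ν ∧ ν (Set.Icc (0 : ℝ) 1)ᶜ = 0 ∧
      ∀ n : ℕ, criticalTwoPoint (d' + 1) (Pi.single i ((n : ℕ) : ℤ)) = ∫ t, t ^ n ∂ν :=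
  h.hausdorffMoment (hpos (by omega)) (hS09 hd) i

end Literature.Probability.LatticeModels

end
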